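import Mathlib
import HarnessLib
import Summits.ValiantsHypothesis.ValiantsHypothesis.Theorems.LacunarySymmetroidMatrixDescartesOsculationLawCuspCubicNonMonicPrelim
import Summits.ValiantsHypothesis.ValiantsHypothesis.Theorems.LacunarySymmetroidMatrixDescartesOsculationLawRankLetterRealRoots

/-!
# ValiantsHypothesis / LacunarySymmetroid — crux `MatrixDescartes` (stmt-ValiantsHypothesis-18050, V1),
# line «osculation-law»: the MONIC QUARTIC cusp curve — counting tools

Towards the splitting `(4, 0)` of the `m = 4` rung (desk RULING #260 (b)).  Tools for the count of a finite
osculation set of `Φ = b⁴ + σ₁b³ + σ₂b² + σ₃b + σ₄` (no definitions, no named facts):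

* `fibre_four_le` — ≤ 4 ordinates over each abscissa (monic quartic), abscissae positive roots of a nonzero `P`;
* `sign_of_pos_root4`, `exists_pos_root_of_sign4` — VIETA SIGNS for the real-rooted monic quartic: a positive root
  exists iff one of `σ₁, σ₂, σ₃, σ₄` is negative (root persistence without eigenvectors);
* `splits_quartic` — the factorised quartic `∏ (X − C μᵢ)` splits; `disc_nonneg_of_dvd_quartic` — a quadratic
  `ℓ₂b² + ℓ₁b + ℓ₀` (`ℓ₂ ≠ 0`) with `K·L = c·Φ` (`c ≠ 0`) is real-rooted (`4ℓ₂ℓ₀ ≤ ℓ₁²`, Mathlib `Splits.of_dvd` +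
  `OsculationLetter.discrim_nonneg_of_splits`); `cubic_prod_of_dvd_quartic` — a cubic `R` (`r₃ ≠ 0`) with
  `K·R = c·Φ` factors as `r₃·∏(b − νⱼ)` (`Splits.of_dvd` + `Splits.eval_eq_prod_roots`).

Honest framing: helper lemmas for a located rung piece of an UNREGISTERED V1 law line; `OsculationLaw`,
`PeelInequality`, `MatrixDescartes`, Conjecture B and `VP ≠ VNP` are OPEN / NOT proved.
-/

-- `Summit.ValiantsHypothesis.ValiantsHypothesis.…` is the tree's mandated single-conjunct layout (Sub = Summit).
set_option linter.dupNamespace false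

noncomputable section

namespace Summit.ValiantsHypothesis.ValiantsHypothesis.Theorems.LacunarySymmetroidMatrixDescartes

open Polynomial Set
open scoped BigOperators

namespace OsculationCuspQuartic

/-! ### Fibres -/

/-- **Four ordinates per abscissa.** [folklore] -/
theorem fibre_four_le (σ₁ σ₂ σ₃ σ₄ P : ℝ[X]) (hP : P ≠ 0) (T : Set (Fin 2 → ℝ))
    (hT : ∀ p ∈ T, 0 < p 0 ∧ P.IsRoot (p 0) ∧
      p 1 ^ 4 + p 1 ^ 3 * σ₁.eval (p 0) + p 1 ^ 2 * σ₂.eval (p 0) + p 1 * σ₃.eval (p 0) + σ₄.eval (p 0) = 0) :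
    T.ncard ≤ 4 * P.support.card := by
  classical
  set TP : Finset ℝ := P.roots.toFinset.filter (fun t => 0 < t) with hTP
  set q : ℝ → ℝ[X] := fun t =>
    X ^ 4 + C (σ₁.eval t) * X ^ 3 + C (σ₂.eval t) * X ^ 2 + C (σ₃.eval t) * X + C (σ₄.eval t) with hq
  have hq_deg : ∀ t, (q t).natDegree ≤ 4 := fun t => by
    show (X ^ 4 + C (σ₁.eval t) * X ^ 3 + C (σ₂.eval t) * X ^ 2 + C (σ₃.eval t) * X + C (σ₄.eval t) :
      ℝ[X]).natDegree ≤ 4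
    refine (natDegree_add_le _ _).trans (max_le ?_ ((natDegree_C _).le.trans (Nat.zero_le _)))
    refine (natDegree_add_le _ _).trans (max_le ?_ ?_)
    · refine (natDegree_add_le _ _).trans (max_le ?_ ?_)
      · refine (natDegree_add_le _ _).trans (max_le (natDegree_X_pow 4).le ?_)
        exact natDegree_C_mul_X_pow_le _ 3 |>.trans (by norm_num)
      · exact natDegree_C_mul_X_pow_le _ 2 |>.trans (by norm_num)
    · exact (natDegree_C_mul_le _ _).trans (natDegree_X_le.trans (by norm_num))
  have hq_ne : ∀ t, q t ≠ 0 := by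
    intro t h0
    have h4 : (q t).coeff 4 = 1 := by
      rw [hq]
      simp only [coeff_add, coeff_C_mul, coeff_X_pow, coeff_X, coeff_C]
      norm_num
    rw [h0, coeff_zero] at h4
    exact zero_ne_one h4
  set S : Finset (Fin 2 → ℝ) :=
    TP.biUnion (fun t => ((q t).roots.toFinset).image (fun b => (![t, b] : Fin 2 → ℝ))) with hS
  have hsub : T ⊆ (S : Set (Fin 2 → ℝ)) := by
    intro p hp
    obtain ⟨htp, hroot, hΦp⟩ := hT p hp
    rw [Finset.mem_coe, hS, Finset.mem_biUnion]
    refine ⟨p 0, ?_, ?_⟩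
    · rw [hTP, Finset.mem_filter, Multiset.mem_toFinset, mem_roots hP]
      exact ⟨hroot, htp⟩
    · rw [Finset.mem_image]
      refine ⟨p 1, ?_, ?_⟩
      · rw [Multiset.mem_toFinset, mem_roots (hq_ne _), hq, IsRoot.def]
        simp only [eval_add, eval_mul, eval_C, eval_pow, eval_X]
        linarith
      · funext i
        fin_cases i <;> rfl
  calc T.ncard ≤ (S : Set (Fin 2 → ℝ)).ncard := Set.ncard_le_ncard hsub (Finset.finite_toSet _)
    _ = S.card := Set.ncard_coe_finset _
    _ ≤ ∑ t ∈ TP, (((q t).roots.toFinset).image (fun b => (![t, b] : Fin 2 → ℝ))).card :=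
        Finset.card_biUnion_le
    _ ≤ ∑ t ∈ TP, 4 := by
        refine Finset.sum_le_sum fun t _ => ?_
        calc _ ≤ ((q t).roots.toFinset).card := Finset.card_image_le
          _ ≤ Multiset.card (q t).roots := Multiset.toFinset_card_le _
          _ ≤ (q t).natDegree := Polynomial.card_roots' _
          _ ≤ 4 := hq_deg t
    _ = 4 * TP.card := by rw [Finset.sum_const, smul_eq_mul, mul_comm]
    _ ≤ 4 * P.support.card := by
        apply Nat.mul_le_mul_left
        calc TP.card = (P.roots.filter (fun t => 0 < t)).toFinset.card := by
              rw [hTP, Multiset.toFinset_filter]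
          _ ≤ Multiset.card (P.roots.filter (fun t => 0 < t)) := Multiset.toFinset_card_le _
          _ ≤ P.support.card := OsculationRankOne.card_roots_filter_pos_le_card_support P

/-! ### Vieta signs for the monic quartic -/

/-- A positive root of the monic quartic forces a negative coefficient. [folklore] -/
theorem sign_of_pos_root4 {σ₁ σ₂ σ₃ σ₄ b₀ : ℝ} (hb₀ : 0 < b₀)
    (hroot : b₀ ^ 4 + b₀ ^ 3 * σ₁ + b₀ ^ 2 * σ₂ + b₀ * σ₃ + σ₄ = 0) :
    σ₁ < 0 ∨ σ₂ < 0 ∨ σ₃ < 0 ∨ σ₄ < 0 := by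
  by_contra h
  push Not at h
  obtain ⟨h1, h2, h3, h4⟩ := h
  have hb4 : 0 < b₀ ^ 4 := pow_pos hb₀ 4
  nlinarith [mul_nonneg (pow_pos hb₀ 3).le h1, mul_nonneg (sq_nonneg b₀) h2, mul_nonneg hb₀.le h3]

/-- A negative coefficient of a real-rooted monic quartic forces a positive root (Vieta, four evaluations).
[folklore] -/
theorem exists_pos_root_of_sign4 {σ₁ σ₂ σ₃ σ₄ : ℝ}
    (hreal : ∃ μ₁ μ₂ μ₃ μ₄ : ℝ, ∀ b : ℝ,
      b ^ 4 + b ^ 3 * σ₁ + b ^ 2 * σ₂ + b * σ₃ + σ₄ = (b - μ₁) * (b - μ₂) * (b - μ₃) * (b - μ₄))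
    (hsign : σ₁ < 0 ∨ σ₂ < 0 ∨ σ₃ < 0 ∨ σ₄ < 0) :
    ∃ b : ℝ, 0 < b ∧ b ^ 4 + b ^ 3 * σ₁ + b ^ 2 * σ₂ + b * σ₃ + σ₄ = 0 := by
  obtain ⟨μ₁, μ₂, μ₃, μ₄, hμ⟩ := hreal
  have e0 := hμ 0
  have e1 := hμ 1
  have em1 := hμ (-1)
  have e2 := hμ 2
  have v1 : σ₁ = -(μ₁ + μ₂ + μ₃ + μ₄) := by
    linear_combination (1 / 2) * e0 - (1 / 2) * e1 - (1 / 6) * em1 + (1 / 6) * e2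
  have v2 : σ₂ = μ₁ * μ₂ + μ₁ * μ₃ + μ₁ * μ₄ + μ₂ * μ₃ + μ₂ * μ₄ + μ₃ * μ₄ := by
    linear_combination -e0 + (1 / 2) * e1 + (1 / 2) * em1
  have v3 : σ₃ = -(μ₁ * μ₂ * μ₃ + μ₁ * μ₂ * μ₄ + μ₁ * μ₃ * μ₄ + μ₂ * μ₃ * μ₄) := by
    linear_combination -(1 / 2) * e0 + e1 - (1 / 3) * em1 - (1 / 6) * e2
  have v4 : σ₄ = μ₁ * μ₂ * μ₃ * μ₄ := by linear_combination e0
  by_cases h1 : 0 < μ₁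
  · exact ⟨μ₁, h1, by rw [hμ]; ring⟩
  by_cases h2 : 0 < μ₂
  · exact ⟨μ₂, h2, by rw [hμ]; ring⟩
  by_cases h3 : 0 < μ₃
  · exact ⟨μ₃, h3, by rw [hμ]; ring⟩
  by_cases h4 : 0 < μ₄
  · exact ⟨μ₄, h4, by rw [hμ]; ring⟩
  push Not at h1 h2 h3 h4
  exfalso
  have p12 := mul_nonneg_of_nonpos_of_nonpos h1 h2
  have p13 := mul_nonneg_of_nonpos_of_nonpos h1 h3
  have p14 := mul_nonneg_of_nonpos_of_nonpos h1 h4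
  have p23 := mul_nonneg_of_nonpos_of_nonpos h2 h3
  have p24 := mul_nonneg_of_nonpos_of_nonpos h2 h4
  have p34 := mul_nonneg_of_nonpos_of_nonpos h3 h4
  have s1 : 0 ≤ σ₁ := by rw [v1]; linarith
  have s2 : 0 ≤ σ₂ := by rw [v2]; linarith
  have s3 : 0 ≤ σ₃ := by
    rw [v3]
    nlinarith [mul_nonpos_of_nonneg_of_nonpos p12 h3, mul_nonpos_of_nonneg_of_nonpos p12 h4,
      mul_nonpos_of_nonneg_of_nonpos p13 h4, mul_nonpos_of_nonneg_of_nonpos p23 h4]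
  have s4 : 0 ≤ σ₄ := by
    rw [v4]
    have : μ₁ * μ₂ * μ₃ * μ₄ = (μ₁ * μ₂) * (μ₃ * μ₄) := by ring
    rw [this]; exact mul_nonneg p12 p34
  rcases hsign with h | h | h | h <;> linarith

/-! ### Factors of the real-rooted quartic are real-rooted -/

/-- The factorised quartic splits. [folklore] -/
theorem splits_quartic (μ₁ μ₂ μ₃ μ₄ : ℝ) :
    ((X - C μ₁) * (X - C μ₂) * (X - C μ₃) * (X - C μ₄) : ℝ[X]).Splits :=
  (((Splits.X_sub_C μ₁).mul (Splits.X_sub_C μ₂)).mul (Splits.X_sub_C μ₃)).mul (Splits.X_sub_C μ₄)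

/-- **A quadratic factor of the quartic is real-rooted.**  If `(k₂b² + k₁b + k₀)·(ℓ₂b² + ℓ₁b + ℓ₀) = c·∏(b − μᵢ)` for
all `b` with `ℓ₂ ≠ 0`, `c ≠ 0`, then `4ℓ₂ℓ₀ ≤ ℓ₁²`. [folklore] -/
theorem disc_nonneg_of_dvd_quartic {k₂ k₁ k₀ l₂ l₁ l₀ c μ₁ μ₂ μ₃ μ₄ : ℝ} (hl₂ : l₂ ≠ 0) (hc : c ≠ 0)
    (hid : ∀ b : ℝ, (k₂ * b ^ 2 + k₁ * b + k₀) * (l₂ * b ^ 2 + l₁ * b + l₀) =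
      c * ((b - μ₁) * (b - μ₂) * (b - μ₃) * (b - μ₄))) :
    4 * (l₂ * l₀) ≤ l₁ ^ 2 := by
  set K : ℝ[X] := C k₂ * X ^ 2 + C k₁ * X + C k₀ with hK
  set L : ℝ[X] := C l₂ * X ^ 2 + C l₁ * X + C l₀ with hL
  set F : ℝ[X] := C c * ((X - C μ₁) * (X - C μ₂) * (X - C μ₃) * (X - C μ₄)) with hF
  have hKL : K * L = F := by
    apply Polynomial.funext
    intro b
    rw [hK, hL, hF]
    simp only [eval_mul, eval_add, eval_C, eval_pow, eval_X, eval_sub]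
    exact hid b
  have hFs : F.Splits := (Splits.C c).mul (splits_quartic μ₁ μ₂ μ₃ μ₄)
  have hF0 : F ≠ 0 := by
    rw [hF]
    refine mul_ne_zero (by rwa [Ne, C_eq_zero]) ?_
    exact mul_ne_zero (mul_ne_zero (mul_ne_zero (X_sub_C_ne_zero _) (X_sub_C_ne_zero _)) (X_sub_C_ne_zero _))
      (X_sub_C_ne_zero _)
  have hLs : L.Splits := Splits.of_dvd hFs hF0 ⟨K, by rw [mul_comm, hKL]⟩
  exact OsculationLetter.discrim_nonneg_of_splits l₂ l₁ l₀ hl₂ hLs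

/-- **A cubic factor of the quartic factors over `ℝ`.**  If `(k₁b + k₀)·(r₃b³ + r₂b² + r₁b + r₀) = c·∏(b − μᵢ)` for all
`b` with `r₃ ≠ 0`, `c ≠ 0`, then `r₃b³ + r₂b² + r₁b + r₀ = r₃·(b − ν₁)(b − ν₂)(b − ν₃)` for some reals `νⱼ`.
[folklore] -/
theorem cubic_prod_of_dvd_quartic {k₁ k₀ r₃ r₂ r₁ r₀ c μ₁ μ₂ μ₃ μ₄ : ℝ} (hr₃ : r₃ ≠ 0) (hc : c ≠ 0)
    (hid : ∀ b : ℝ, (k₁ * b + k₀) * (r₃ * b ^ 3 + r₂ * b ^ 2 + r₁ * b + r₀) =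
      c * ((b - μ₁) * (b - μ₂) * (b - μ₃) * (b - μ₄))) :
    ∃ ν₁ ν₂ ν₃ : ℝ, ∀ b : ℝ,
      r₃ * b ^ 3 + r₂ * b ^ 2 + r₁ * b + r₀ = r₃ * ((b - ν₁) * (b - ν₂) * (b - ν₃)) := by
  set K : ℝ[X] := C k₁ * X + C k₀ with hK
  set Rp : ℝ[X] := C r₃ * X ^ 3 + C r₂ * X ^ 2 + C r₁ * X + C r₀ with hRp
  set F : ℝ[X] := C c * ((X - C μ₁) * (X - C μ₂) * (X - C μ₃) * (X - C μ₄)) with hF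
  have hKR : K * Rp = F := by
    apply Polynomial.funext
    intro b
    rw [hK, hRp, hF]
    simp only [eval_mul, eval_add, eval_C, eval_pow, eval_X, eval_sub]
    exact hid b
  have hFs : F.Splits := (Splits.C c).mul (splits_quartic μ₁ μ₂ μ₃ μ₄)
  have hF0 : F ≠ 0 := by
    rw [hF]
    refine mul_ne_zero (by rwa [Ne, C_eq_zero]) ?_
    exact mul_ne_zero (mul_ne_zero (mul_ne_zero (X_sub_C_ne_zero _) (X_sub_C_ne_zero _)) (X_sub_C_ne_zero _))
      (X_sub_C_ne_zero _)
  have hRs : Rp.Splits := Splits.of_dvd hFs hF0 ⟨K, by rw [mul_comm, hKR]⟩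
  have hdeg : Rp.natDegree = 3 := by rw [hRp]; exact natDegree_cubic hr₃
  have hlc : Rp.leadingCoeff = r₃ := by rw [hRp]; exact leadingCoeff_cubic hr₃
  have hcard : Rp.roots.card = 3 := by rw [splits_iff_card_roots.1 hRs, hdeg]
  obtain ⟨ν₁, ν₂, ν₃, hν⟩ := Multiset.card_eq_three.1 hcard
  refine ⟨ν₁, ν₂, ν₃, fun b => ?_⟩
  have h := hRs.eval_eq_prod_roots b
  rw [hlc, hν] at h
  have hl : Rp.eval b = r₃ * b ^ 3 + r₂ * b ^ 2 + r₁ * b + r₀ := by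
    rw [hRp]; simp only [eval_add, eval_mul, eval_C, eval_pow, eval_X]
  rw [← hl, h]
  simp only [Multiset.insert_eq_cons, Multiset.map_cons, Multiset.map_singleton, Multiset.prod_cons,
    Multiset.prod_singleton]
  ring

end OsculationCuspQuartic

end Summit.ValiantsHypothesis.ValiantsHypothesis.Theorems.LacunarySymmetroidMatrixDescartes
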